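import Mathlib
import Summits.Ventures.HodgeRepro2.T5EmbeddingTorsor
import Summits.Ventures.HodgeRepro2.Defs

/-!
# T5CMTypePlaces — «the p-adic places induced by the elements of a CM type Σ via ι_p»

Tier-5 support (seat p7, cell pub-hodge-repro2), fourth file of the embedding chain, for
route/T5-CHECK-G-p7.md §12.2 row P1.5 («Fix a p-ordinary CM type Σ, namely Σ is a CM type of K
such that p-adic places induced by elements in Σ via ι_p are disjoint from those induced by
elements in Σc») and CHECK-G S0 («p splits completely in E ⇒ every CM type is p-ordinary»), now
in the cell's own CM-type vocabulary (p1's `IsCMType E Σ`: `Σ ⊆ Hom(E, ℂ)` contains exactly one of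
each conjugate pair).

The print's `ι_p : ℚ̄ → ℂ_p` is represented by a pair of embeddings `ιC : E →+* ℂ`,
`ι : E →+* ℚ_[p]` (the reading «ι = ι_p ∘ ιC»; `ℂ_p` is not in Mathlib): for `E/ℚ` Galois,
`Hom(E, ℂ)` and `Hom(E, ℚ_p)` are both `Gal(E/ℚ)`-torsors (`galOfComplex`, `T5EmbeddingTorsor`),
and «the p-adic place induced by φ = ιC ∘ σ via ι_p» is `inducedPlace ιC ι φ := inducedPrime (ι ∘ σ)`.

* `inducedPlace_injective`, `inducedPlace_liesOver`, `inducedPlace_surjective` (onto the primes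
  above `p`; every prime above `p` has degree one because `E/ℚ` is Galois and `ι` exists);
* `disjoint_conjType_of_isCMType` / `union_conjType_of_isCMType` (`Σ ∩ Σc = ∅`, `Σ ∪ Σc = Hom(E, ℂ)`);
* **`isOrdinary_of_isCMType`**: for every CM type `Σ`, the places induced by `Σ` and by `Σc` are
  disjoint and together exhaust the primes above `p` — Hsieh's (ord) for the datum, P1.5.

What stays prose: only the reading «ι = ι_p ∘ ιC» (the print's single `ι_p`).
-/

namespace Summit.Ventures.HodgeRepro2.T5CMTypePlaces

open IsDedekindDomain NumberField T5DegreeOneEmbeddings T5EmbeddingPrimeEquiv T5EmbeddingTorsor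

variable {E : Type*} [Field E] [NumberField E] {p : ℕ} [hp : Fact p.Prime]

section complexTorsor

variable (ιC : E →+* ℂ)

/-- `σ ↦ ιC ∘ σ`. -/
noncomputable def compGalC (σ : E ≃ₐ[ℚ] E) : E →+* ℂ := ιC.comp σ.toAlgHom.toRingHom

/-- `compGalC ιC σ x = ιC (σ x)`. -/
@[simp]
theorem compGalC_apply (σ : E ≃ₐ[ℚ] E) (x : E) : compGalC ιC σ x = ιC (σ x) := rfl

/-- `σ ↦ ιC ∘ σ` is injective. -/
theorem compGalC_injective : Function.Injective (compGalC ιC) := by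
  intro σ τ h
  ext x
  exact ιC.injective (RingHom.congr_fun h x)

variable [IsGalois ℚ E]

/-- `σ ↦ ιC ∘ σ` is a bijection `Gal(E/ℚ) → Hom(E, ℂ)` (`#Hom(E, ℂ) = [E : ℚ] = #Gal(E/ℚ)`). -/
theorem compGalC_bijective : Function.Bijective (compGalC ιC) :=
  (compGalC_injective ιC).bijective_of_nat_card_le
    (by rw [Nat.card_eq_fintype_card, NumberField.Embeddings.card E ℂ,
      IsGalois.card_aut_eq_finrank])

/-- The torsor structure of `Hom(E, ℂ)`: `φ ↦ the σ with φ = ιC ∘ σ`. -/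
noncomputable def galOfComplex : (E →+* ℂ) ≃ (E ≃ₐ[ℚ] E) :=
  (Equiv.ofBijective _ (compGalC_bijective ιC)).symm

/-- `ιC ∘ galOfComplex ιC φ = φ`. -/
theorem compGalC_galOfComplex (φ : E →+* ℂ) : compGalC ιC (galOfComplex ιC φ) = φ :=
  (Equiv.ofBijective _ (compGalC_bijective ιC)).apply_symm_apply φ

/-- `galOfComplex ιC (ιC ∘ σ) = σ`. -/
theorem galOfComplex_compGalC (σ : E ≃ₐ[ℚ] E) : galOfComplex ιC (compGalC ιC σ) = σ :=
  (Equiv.ofBijective _ (compGalC_bijective ιC)).symm_apply_apply σ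

end complexTorsor

section places

variable [IsGalois ℚ E] (ιC : E →+* ℂ) (ι : E →+* ℚ_[p])

/-- «The p-adic place induced by φ via ι_p»: for `φ = ιC ∘ σ`, the prime of `𝓞 E` induced by
`ι ∘ σ : E → ℚ_p` (reading: `ι = ι_p ∘ ιC`). -/
noncomputable def inducedPlace (φ : E →+* ℂ) : HeightOneSpectrum (𝓞 E) :=
  inducedPrime (compGal ι (galOfComplex ιC φ))

/-- `inducedPlace ιC ι (ιC ∘ σ) = inducedPrime (ι ∘ σ)`. -/
theorem inducedPlace_compGalC (σ : E ≃ₐ[ℚ] E) :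
    inducedPlace ιC ι (compGalC ιC σ) = inducedPrime (compGal ι σ) := by
  rw [inducedPlace, galOfComplex_compGalC]

/-- Distinct complex embeddings induce distinct `p`-adic places. -/
theorem inducedPlace_injective : Function.Injective (inducedPlace ιC ι) :=
  inducedPrime_injective.comp ((compGal_injective ι).comp (galOfComplex ιC).injective)

/-- Every induced place lies over `p`. -/
theorem inducedPlace_liesOver (φ : E →+* ℂ) :
    (inducedPlace ιC ι φ).asIdeal.LiesOver (Ideal.span {(p : ℤ)}) :=
  inducedPrime_liesOver _

/-- Every prime above `p` is induced by some complex embedding (every prime above `p` has degree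
one, `E/ℚ` being Galois with the degree-one prime induced by `ι`). -/
theorem inducedPlace_surjective (w : HeightOneSpectrum (𝓞 E))
    [hw : w.asIdeal.LiesOver (Ideal.span {(p : ℤ)})] : ∃ φ : E →+* ℂ, inducedPlace ιC ι φ = w := by
  have hdeg : w.asIdeal.ramificationIdx ℤ * w.asIdeal.inertiaDeg ℤ = 1 :=
    forall_degree_one_of_isGalois E p (inducedPrime ι) (degree_one_inducedPrime ι) w hw
  obtain ⟨σ, hσ⟩ := exists_compGal_eq ι (embedding w p hdeg)
  refine ⟨compGalC ιC σ, ?_⟩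
  rw [inducedPlace_compGalC, hσ]
  exact inducedPrime_embedding w hdeg

/-- The image of `inducedPlace` is exactly the set of primes above `p`. -/
theorem range_inducedPlace :
    Set.range (inducedPlace ιC ι) =
      {w : HeightOneSpectrum (𝓞 E) | w.asIdeal.LiesOver (Ideal.span {(p : ℤ)})} := by
  ext w
  constructor
  · rintro ⟨φ, rfl⟩
    exact inducedPlace_liesOver ιC ι φ
  · intro hw
    haveI : w.asIdeal.LiesOver (Ideal.span {(p : ℤ)}) := hw
    exact inducedPlace_surjective ιC ι w

end places

section cmType

/-- The conjugate `Σc` of a set of complex embeddings. -/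
def conjType (Φ : Set (E →+* ℂ)) : Set (E →+* ℂ) := ComplexEmbedding.conjugate '' Φ

omit [NumberField E] in
/-- `φ ∈ Σc ↔ φ̄ ∈ Σ`. -/
theorem mem_conjType_iff (Φ : Set (E →+* ℂ)) (φ : E →+* ℂ) :
    φ ∈ conjType Φ ↔ ComplexEmbedding.conjugate φ ∈ Φ := by
  constructor
  · rintro ⟨ψ, hψ, rfl⟩
    rwa [ComplexEmbedding.involutive_conjugate E ψ]
  · intro h
    exact ⟨_, h, ComplexEmbedding.involutive_conjugate E φ⟩

omit [NumberField E] in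
/-- A CM type is disjoint from its conjugate. -/
theorem disjoint_conjType_of_isCMType {Φ : Set (E →+* ℂ)} (hΦ : IsCMType E Φ) :
    Disjoint Φ (conjType Φ) := by
  rw [Set.disjoint_left]
  intro φ hφ hφc
  rw [mem_conjType_iff] at hφc
  rcases hΦ φ with ⟨-, h⟩ | ⟨-, h⟩
  · exact h hφc
  · exact h hφ

omit [NumberField E] in
/-- A CM type and its conjugate exhaust `Hom(E, ℂ)`. -/
theorem union_conjType_of_isCMType {Φ : Set (E →+* ℂ)} (hΦ : IsCMType E Φ) :
    Φ ∪ conjType Φ = Set.univ := by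
  ext φ
  simp only [Set.mem_union, mem_conjType_iff, Set.mem_univ, iff_true]
  rcases hΦ φ with ⟨h, -⟩ | ⟨h, -⟩
  · exact Or.inl h
  · exact Or.inr h

variable [IsGalois ℚ E] (ιC : E →+* ℂ) (ι : E →+* ℚ_[p])

/-- The places induced by a CM type `Σ` are disjoint from those induced by `Σc`. -/
theorem disjoint_inducedPlace_of_isCMType {Φ : Set (E →+* ℂ)} (hΦ : IsCMType E Φ) :
    Disjoint (inducedPlace ιC ι '' Φ) (inducedPlace ιC ι '' conjType Φ) :=
  (Set.disjoint_image_iff (inducedPlace_injective ιC ι)).mpr (disjoint_conjType_of_isCMType hΦ)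

/-- The places induced by `Σ` and by `Σc` together are all the primes above `p`. -/
theorem inducedPlace_union_of_isCMType {Φ : Set (E →+* ℂ)} (hΦ : IsCMType E Φ) :
    inducedPlace ιC ι '' Φ ∪ inducedPlace ιC ι '' conjType Φ =
      {w : HeightOneSpectrum (𝓞 E) | w.asIdeal.LiesOver (Ideal.span {(p : ℤ)})} := by
  rw [← Set.image_union, union_conjType_of_isCMType hΦ, Set.image_univ, range_inducedPlace]

/-- **(ord) for every CM type** (CHECK-G S0 / §12.2 row P1.5): when `E/ℚ` is Galois and has an
embedding into `ℚ_p` (so that `p` splits completely), every CM type `Σ` is `p`-ordinary — the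
`p`-adic places induced by the elements of `Σ` (via `ι = ι_p ∘ ιC`) are disjoint from those
induced by the elements of `Σc`, and together they are all the places above `p`. -/
theorem isOrdinary_of_isCMType {Φ : Set (E →+* ℂ)} (hΦ : IsCMType E Φ) :
    Disjoint (inducedPlace ιC ι '' Φ) (inducedPlace ιC ι '' conjType Φ) ∧
      inducedPlace ιC ι '' Φ ∪ inducedPlace ιC ι '' conjType Φ =
        {w : HeightOneSpectrum (𝓞 E) | w.asIdeal.LiesOver (Ideal.span {(p : ℤ)})} :=
  ⟨disjoint_inducedPlace_of_isCMType ιC ι hΦ, inducedPlace_union_of_isCMType ιC ι hΦ⟩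

end cmType

end Summit.Ventures.HodgeRepro2.T5CMTypePlaces
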